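import Summits.BirchSwinnertonDyer.BirchSwinnertonDyer.Theorems.ByReductionTypeAtTwoMultTowerNS2TwistedTateAlgebra
import HarnessLib

/-!
# Route `ByReductionTypeAtTwo`, crux `MultUpperHalfAtTwo` (item stmt-BirchSwinnertonDyer-19922), TOWER road, the
# «ONE BIT AT A NON-SPLIT 2» rows: KERNEL BRICK 16b — `2`-torsion coinvariant classes of the twisted Tate module:
# the unit classes come from Hilbert 90 with an `F_n`-rational norm invariant (scope memo S3/S6)

HONEST FRAMING (cell `bsd-2adic`, run/shared/lean/pub/bsd-2adic/, seat `bsd-2adic-tower-1` GEN 9, HUMAN RULINGS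
D-0036 / D-0054 / D-0074): TOOL theorems only (no definition, no named fact, no `sorry`); closes nothing by itself;
nothing booked; BSD is not proved by any of this. Module M6 of the KERNELISATION of the MEMO binder
`MultTowerNS2.localTowerKerTwoTorsion_le_two_nonsplitTwo_of_tateUnit` (scope memo HOME/tower/SCOPE-hNS2one-kernel-GEN8.md).
Setting as in BRICKs 15/16a: `v ∋ 2`, `K = ℚ_v`, `Γ`, the local layer subgroups `H_m` of the cyclotomic `ℤ₂`-tower and
`H_∞`, an element `t` with `σ t = ±t`, a flip `τ₀ ∈ H_∞`, `g ∈ H_n` fixing `t` with `κ(res g) = 2^n u_g`, and a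
`Γ`-fixed non-zero `Q ∈ K̄` no power of which is `1` (the Tate parameter). The twisted Tate module is
`T = {x ∈ K̄^{H_∞ ∩ Stab(t)} : τ₀x · x ∈ Q^ℤ}` modulo `Q^ℤ`, and `g` acts on it.

* `isClosed_stabilizer`, `exists_forall_mem_localSubgroup_layerSubgroup_add_smul_eq₂` — finite levels `n + R` for
  two elements of `K̄^{H_∞ ∩ Stab(t)}` at once (BRICK 15 + compactness);
* `flip_smul_coboundary_mul_coboundary` — `τ₀(σz/z) · (σz/z) = 1` for `z ∈ T` and `σ` fixing `t` (the exponent map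
  `a` kills `(g−1)T`);
* `exists_coboundary_of_sq_eq` — **C3**: if `x ∈ T` with `τ₀x · x = 1` has `x² = Q^j · gz/z` (`z ∈ T`), then `j = 0`,
  `N_{R+1}(x) = 1`, and by the cyclic Hilbert 90 of BRICK 16a `x = g(y)/y` with `y ∈ K̄^{H_∞ ∩ Stab(t)}`, `y ≠ 0`,
  whose norm `v = y · τ₀y` is a NON-ZERO ELEMENT OF `F_n` (fixed by all of `H_n`).

References: J. Neukirch, *ANT* IV (3.5); R. Greenberg, LNM 1716 §3 (pp. 87–93); scope memo S3–S6.
-/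

set_option autoImplicit false
-- the Theorems namespace of this sub repeats the summit name by design (D-0017 nested layout: Summit.<S>.<Sub>)
set_option linter.dupNamespace false

noncomputable section

open scoped Classical IntermediateField

namespace Summit.BirchSwinnertonDyer.BirchSwinnertonDyer.Theorems.MultTowerNS2

open NumberField IsDedekindDomain Field PadicInt Literature.NumberTheory.EllipticCurves
  Literature.NumberTheory.GaloisRepresentations

variable {κ : ZpExtension ℚ 2}

/-! ### Levels -/

/-- `H_{m'} ≤ H_m` for `m ≤ m'`. [folklore] -/
theorem localSubgroup_layerSubgroup_le_of_le (v : HeightOneSpectrum (𝓞 ℚ)) {m m' : ℕ} (h : m ≤ m') :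
    localSubgroup (κ.layerSubgroup m') (v.adicCompletion ℚ) ≤ localSubgroup (κ.layerSubgroup m) (v.adicCompletion ℚ) :=
  Subgroup.comap_mono (κ.layerSubgroup_antitone h)

/-- The stabiliser of an element of `K̄_v` in `Γ_{ℚ_v}` is closed (it contains the open subgroup `Gal(K̄/K(t))`).
[folklore] -/
theorem isClosed_stabilizer (v : HeightOneSpectrum (𝓞 ℚ)) (t : AlgebraicClosure (v.adicCompletion ℚ)) :
    IsClosed (MulAction.stabilizer (absoluteGaloisGroup (v.adicCompletion ℚ)) t :
      Set (absoluteGaloisGroup (v.adicCompletion ℚ))) := by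
  have hint : IsIntegral (v.adicCompletion ℚ) t := Algebra.IsIntegral.isIntegral t
  haveI : FiniteDimensional (v.adicCompletion ℚ) (v.adicCompletion ℚ)⟮t⟯ := IntermediateField.adjoin.finiteDimensional hint
  refine Subgroup.isClosed_of_isOpen _ (Subgroup.isOpen_mono ?_ (IntermediateField.fixingSubgroup_isOpen (v.adicCompletion ℚ)⟮t⟯))
  intro σ hσ
  exact MulAction.mem_stabilizer_iff.mpr
    ((IntermediateField.mem_fixingSubgroup_iff _ _).mp hσ t (IntermediateField.mem_adjoin_simple_self _ t))

/-- **A common finite level for two elements**: if `x, z ∈ K̄_v` are fixed by `H_∞ ∩ Stab(t)`, then for some `R` both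
are fixed by `H_{n+R} ∩ Stab(t)`. [cite: NeukirchANT1999, Ch. IV §1] -/
theorem exists_forall_mem_localSubgroup_layerSubgroup_add_smul_eq₂ (v : HeightOneSpectrum (𝓞 ℚ)) (n : ℕ)
    (t x z : AlgebraicClosure (v.adicCompletion ℚ))
    (hx : ∀ h ∈ localSubgroup κ.kerSubgroup (v.adicCompletion ℚ), h • t = t → h • x = x)
    (hz : ∀ h ∈ localSubgroup κ.kerSubgroup (v.adicCompletion ℚ), h • t = t → h • z = z) :
    ∃ R : ℕ, (∀ h ∈ localSubgroup (κ.layerSubgroup (n + R)) (v.adicCompletion ℚ), h • t = t → h • x = x) ∧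
      (∀ h ∈ localSubgroup (κ.layerSubgroup (n + R)) (v.adicCompletion ℚ), h • t = t → h • z = z) := by
  have hS := isClosed_stabilizer v t
  obtain ⟨m₁, hm₁⟩ := exists_forall_mem_localSubgroup_layerSubgroup_smul_eq (κ := κ) v _ hS x
    (fun h hh hht ↦ hx h hh (MulAction.mem_stabilizer_iff.mp hht))
  obtain ⟨m₂, hm₂⟩ := exists_forall_mem_localSubgroup_layerSubgroup_smul_eq (κ := κ) v _ hS z
    (fun h hh hht ↦ hz h hh (MulAction.mem_stabilizer_iff.mp hht))
  refine ⟨m₁ + m₂, fun h hh hht ↦ hm₁ h (localSubgroup_layerSubgroup_le_of_le v (by omega) hh)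
    (MulAction.mem_stabilizer_iff.mpr hht), fun h hh hht ↦ hm₂ h (localSubgroup_layerSubgroup_le_of_le v (by omega) hh)
    (MulAction.mem_stabilizer_iff.mpr hht)⟩

/-! ### The exponent of a coboundary vanishes -/

/-- **`τ₀(σz/z) · (σz/z) = 1`**: for `σ` fixing `t` and the `Γ`-fixed `Q`, a flip `τ₀ ∈ N ⊴ Γ`, and `z ≠ 0` fixed by
`N ∩ Stab(t)` with `τ₀z · z = Q^{j'}` — the exponent map `x ↦ a(x)` (`τ₀x·x = Q^{a(x)}`) kills `σz/z`. [folklore] -/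
theorem flip_smul_coboundary_mul_coboundary {v : HeightOneSpectrum (𝓞 ℚ)} {t : AlgebraicClosure (v.adicCompletion ℚ)}
    (ht : ∀ σ : absoluteGaloisGroup (v.adicCompletion ℚ), σ • t = t ∨ σ • t = -t)
    {N : Subgroup (absoluteGaloisGroup (v.adicCompletion ℚ))} [N.Normal] {τ₀ : absoluteGaloisGroup (v.adicCompletion ℚ)}
    (hτ₀ : τ₀ ∈ N) (hτ₀t : τ₀ • t = -t) {σ : absoluteGaloisGroup (v.adicCompletion ℚ)} (hσt : σ • t = t)
    {Q : AlgebraicClosure (v.adicCompletion ℚ)} (hQ0 : Q ≠ 0) (hQσ : σ • Q = Q)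
    {z : AlgebraicClosure (v.adicCompletion ℚ)} (hz0 : z ≠ 0)
    (hzL : ∀ h ∈ N, h • t = t → h • z = z) {j' : ℤ} (hzj : τ₀ • z * z = Q ^ j') :
    τ₀ • (σ • z / z) * (σ • z / z) = 1 := by
  have hσz0 : σ • z ≠ 0 := (smul_ne_zero_iff_ne σ).mpr hz0
  have hQj : Q ^ j' ≠ 0 := zpow_ne_zero _ hQ0
  have hτz : τ₀ • z = Q ^ j' / z := eq_div_of_mul_eq hz0 hzj
  rw [smul_div₀', flip_smul_smul_comm ht hτ₀ hτ₀t hσt hzL, hτz, smul_div₀', smul_zpow₀', hQσ]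
  field_simp

/-! ### C3: unit `2`-torsion classes are coboundaries with an `F_n`-rational norm -/

/-- **C3 (scope S3/S6).** Let `x ∈ K̄^{H_∞ ∩ Stab(t)}` with `τ₀x · x = 1` and `x² = Q^j · gz/z` for some `z` of the twisted
Tate module (`z ≠ 0` in `K̄^{H_∞ ∩ Stab(t)}` with `τ₀z · z ∈ Q^ℤ`). Then `x = g(y)/y` for some non-zero
`y ∈ K̄^{H_∞ ∩ Stab(t)}` whose norm `y · τ₀y` is non-zero and fixed by ALL of `H_n` (an element of `F_n`). Proof: the
exponent count gives `j = 0`; at a finite level `n + R` one has `N_R(x)² = N_R(gz)/N_R(z) = 1`, so `N_{R+1}(x) = N_R(x)² = 1`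
and the cyclic Hilbert 90 of BRICK 16a applies; `g(y τ₀y) = (xy)·τ₀(xy) = y τ₀y`, `τ₀(y τ₀ y) = y τ₀ y`, and `H_n` is
generated by `H_{n+R+1} ∩ Stab(t)`, `τ₀` and `g` (BRICK 15). [cite: GreenbergLNM1716, §3 (pp. 87–89)] -/
theorem exists_coboundary_of_sq_eq (v : HeightOneSpectrum (𝓞 ℚ))
    (n : ℕ) {g : absoluteGaloisGroup (v.adicCompletion ℚ)} {ug : ℤ_[2]ˣ}
    (hug : ((κ (resGal (K := ℚ) (v.adicCompletion ℚ) g)).toAdd : ℤ_[2]) = 2 ^ n * (ug : ℤ_[2]))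
    {t : AlgebraicClosure (v.adicCompletion ℚ)}
    (ht : ∀ σ : absoluteGaloisGroup (v.adicCompletion ℚ), σ • t = t ∨ σ • t = -t) (hgt : g • t = t)
    {τ₀ : absoluteGaloisGroup (v.adicCompletion ℚ)} (hτ₀ : τ₀ ∈ localSubgroup κ.kerSubgroup (v.adicCompletion ℚ))
    (hτ₀t : τ₀ • t = -t) {Q : AlgebraicClosure (v.adicCompletion ℚ)}
    (hQfix : ∀ σ : absoluteGaloisGroup (v.adicCompletion ℚ), σ • Q = Q) (hQ0 : Q ≠ 0)
    (hQtor : ∀ j : ℤ, Q ^ j = 1 → j = 0)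
    {x : AlgebraicClosure (v.adicCompletion ℚ)}
    (hxL : ∀ h ∈ localSubgroup κ.kerSubgroup (v.adicCompletion ℚ), h • t = t → h • x = x) (hxU : τ₀ • x * x = 1)
    {j : ℤ} {z : AlgebraicClosure (v.adicCompletion ℚ)} (hz0 : z ≠ 0)
    (hzL : ∀ h ∈ localSubgroup κ.kerSubgroup (v.adicCompletion ℚ), h • t = t → h • z = z)
    {j' : ℤ} (hzj : τ₀ • z * z = Q ^ j') (hx2 : x ^ 2 = Q ^ j * (g • z / z)) :
    ∃ y : AlgebraicClosure (v.adicCompletion ℚ), y ≠ 0 ∧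
      (∀ h ∈ localSubgroup κ.kerSubgroup (v.adicCompletion ℚ), h • t = t → h • y = y) ∧ x = g • y / y ∧
      y * τ₀ • y ≠ 0 ∧
      ∀ h ∈ localSubgroup (κ.layerSubgroup n) (v.adicCompletion ℚ), h • (y * τ₀ • y) = y * τ₀ • y := by
  -- normality of the local subgroups
  haveI hHin : (localSubgroup κ.kerSubgroup (v.adicCompletion ℚ)).Normal := by
    rw [localSubgroup_eq_comap]; exact Subgroup.Normal.comap inferInstance _
  have hHmn : ∀ m, (localSubgroup (κ.layerSubgroup m) (v.adicCompletion ℚ)).Normal := fun m ↦ by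
    rw [localSubgroup_eq_comap]; exact Subgroup.Normal.comap inferInstance _
  have hile : ∀ m, localSubgroup κ.kerSubgroup (v.adicCompletion ℚ) ≤ localSubgroup (κ.layerSubgroup m) (v.adicCompletion ℚ) :=
    fun m τ hτ ↦ by
      rw [mem_localSubgroup_iff] at hτ ⊢
      exact κ.kerSubgroup_le_layerSubgroup m hτ
  have hgit : ∀ i : ℕ, (g ^ i) • t = t := fun i ↦ by
    induction i with
    | zero => rw [pow_zero, one_smul]
    | succ i ih => rw [pow_succ, mul_smul, hgt, ih]
  -- (1) `j = 0`
  have hgz0 : g • z ≠ 0 := (smul_ne_zero_iff_ne g).mpr hz0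
  have hcob : τ₀ • (g • z / z) * (g • z / z) = 1 :=
    flip_smul_coboundary_mul_coboundary ht hτ₀ hτ₀t hgt hQ0 (hQfix g) hz0 hzL hzj
  have hj : j = 0 := by
    have h1 : τ₀ • (x ^ 2) * x ^ 2 = 1 := by rw [smul_pow', ← mul_pow, hxU, one_pow]
    rw [hx2, smul_mul', smul_zpow₀', hQfix τ₀] at h1
    have h2 : Q ^ (2 * j) = 1 := by
      rw [two_mul, zpow_add₀ hQ0]
      linear_combination (-(Q ^ j * Q ^ j)) * hcob + h1
    have := hQtor _ h2
    omega
  rw [hj, zpow_zero, one_mul] at hx2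
  -- (2) a common finite level `n + R` for `x` and `z`
  obtain ⟨R, hxR, hzR⟩ := exists_forall_mem_localSubgroup_layerSubgroup_add_smul_eq₂ (κ := κ) v n t x z hxL hzL
  have hgRmem : g ^ 2 ^ R ∈ localSubgroup (κ.layerSubgroup (n + R)) (v.adicCompletion ℚ) :=
    (pow_mem_localSubgroup_layerSubgroup_iff (κ := κ) v n R hug _).mpr dvd_rfl
  have hgRx : (g ^ 2 ^ R) • x = x := hxR _ hgRmem (hgit _)
  have hgRz : (g ^ 2 ^ R) • z = z := hzR _ hgRmem (hgit _)
  -- (3) `N_{R+1}(x) = 1`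
  have hprodz : (∏ i ∈ Finset.range (2 ^ R), (g ^ i) • (g • z / z)) = 1 := by
    rw [Finset.prod_congr rfl fun i _ ↦ show (g ^ i) • (g • z / z) = (g ^ i) • (g • z) * (g ^ i) • z⁻¹ by
        rw [div_eq_mul_inv, smul_mul'], Finset.prod_mul_distrib, prod_smul_smul_eq g (2 ^ R) hgRz, prod_smul_inv,
      mul_inv_cancel₀]
    exact Finset.prod_ne_zero_iff.mpr fun i _ ↦ (smul_ne_zero_iff_ne _).mpr hz0
  have hNR2 : (∏ i ∈ Finset.range (2 ^ R), (g ^ i) • x) ^ 2 = 1 := by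
    rw [sq, ← prod_smul_mul, ← sq, hx2, hprodz]
  have hNR1 : (∏ i ∈ Finset.range (2 ^ (R + 1)), (g ^ i) • x) = 1 := by
    rw [pow_succ', prod_smul_range_two_mul, pow_smul_prod_smul_eq g (2 ^ R) hgRx, ← sq, hNR2]
  -- (4) cyclic Hilbert 90 at level `n + R + 1`
  have hxR1 : ∀ h ∈ localSubgroup (κ.layerSubgroup (n + (R + 1))) (v.adicCompletion ℚ), h • t = t → h • x = x :=
    fun h hh hht ↦ hxR h (localSubgroup_layerSubgroup_le_of_le v (by omega) hh) hht
  obtain ⟨y, hy0, hyR, hxy⟩ := exists_eq_smul_div_of_prod_smul_eq_one (κ := κ) v n (R + 1) hug ht hgt hxR1 hNR1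
  have hyL : ∀ h ∈ localSubgroup κ.kerSubgroup (v.adicCompletion ℚ), h • t = t → h • y = y :=
    fun h hh hht ↦ hyR h (hile _ hh) hht
  have hτy0 : τ₀ • y ≠ 0 := (smul_ne_zero_iff_ne τ₀).mpr hy0
  have hgy : g • y = x * y := by rw [hxy, div_mul_cancel₀ _ hy0]
  -- (5) the norm `y · τ₀ y` is fixed by `g`, by `τ₀`, by `H_{n+R+1} ∩ Stab(t)`, hence by `H_n`
  haveI := hHmn (n + (R + 1))
  have hgv : g • (y * τ₀ • y) = y * τ₀ • y := by
    rw [smul_mul', ← flip_smul_smul_comm ht hτ₀ hτ₀t hgt hyL, hgy, smul_mul']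
    linear_combination (y * τ₀ • y) * hxU
  have hτv : τ₀ • (y * τ₀ • y) = y * τ₀ • y := by
    rw [smul_mul', flip_smul_flip_smul hτ₀ hτ₀t hyL, mul_comm]
  have hτyR : ∀ h ∈ localSubgroup (κ.layerSubgroup (n + (R + 1))) (v.adicCompletion ℚ), h • t = t → h • (τ₀ • y) = τ₀ • y :=
    smul_mem_of_forall_mem_smul_eq ht _ hyR τ₀
  have hvR : ∀ h ∈ localSubgroup (κ.layerSubgroup (n + (R + 1))) (v.adicCompletion ℚ), h • (y * τ₀ • y) = y * τ₀ • y := by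
    intro h hh
    rcases ht h with hht | hht
    · rw [smul_mul', hyR h hh hht, hτyR h hh hht]
    · -- `h = τ₀ · (τ₀⁻¹ h)` with `τ₀⁻¹ h ∈ H_{n+R+1} ∩ Stab(t)`
      have hmem : τ₀⁻¹ * h ∈ localSubgroup (κ.layerSubgroup (n + (R + 1))) (v.adicCompletion ℚ) :=
        Subgroup.mul_mem _ (Subgroup.inv_mem _ (hile _ hτ₀)) hh
      have hfix : (τ₀⁻¹ * h) • t = t := by
        rw [mul_smul, hht, smul_neg, inv_smul_eq_smul_of_smul_eq_or (Or.inr hτ₀t), hτ₀t, neg_neg]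
      have h1 : (τ₀⁻¹ * h) • (y * τ₀ • y) = y * τ₀ • y := by
        rw [smul_mul', hyR _ hmem hfix, hτyR _ hmem hfix]
      rw [mul_smul, inv_smul_eq_iff] at h1
      rw [h1, hτv]
  have hgiv : ∀ i : ℕ, (g ^ i) • (y * τ₀ • y) = y * τ₀ • y := fun i ↦ by
    induction i with
    | zero => rw [pow_zero, one_smul]
    | succ i ih => rw [pow_succ, mul_smul, hgv, ih]
  refine ⟨y, hy0, hyL, hxy, mul_ne_zero hy0 hτy0, fun h hh ↦ ?_⟩
  obtain ⟨i, -, hi⟩ := exists_pow_inv_mul_mem_localSubgroup_layerSubgroup (κ := κ) v n (R + 1) hug hh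
  have h1 := hvR _ hi
  rw [mul_smul, inv_smul_eq_iff, hgiv] at h1
  exact h1

end Summit.BirchSwinnertonDyer.BirchSwinnertonDyer.Theorems.MultTowerNS2

end
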